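import Literature.MathematicalPhysics.QuantumFieldTheory.Balaban1983to89.B9Eq342GreenPrimeSupBound
import Literature.MathematicalPhysics.QuantumFieldTheory.Balaban1983to89.B9Eq342SupNormBootstrapWeightedChain
import Literature.MathematicalPhysics.QuantumFieldTheory.Balaban1983to89.B9Eq342BlockDecayWeightedSum

/-!
# `Balaban1983to89.B9Eq342GreenPrimeSupBoundDecay` — T. Bałaban, *Propagators for lattice gauge theories in a background field*, Commun. Math. Phys. **99**
# (1985) 389–434 [Balaban1985BackgroundPropagators] Thm 3.1 (3.42) p. 397, FIRST ENTRY **WITH ITS DECAY FACTOR**, AT THE TOP LEVEL, FOR PRINT's OWN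
# `G′(U) = (Δ′_{a′}(U))⁻¹` (3.24)–(3.25) p. 394 (`B9Eq3119DeltaPiCarrier.GpOfU`): **`‖(G′(U)f)(x₀)‖ ≤ (B₁·e^{−κ′d(u,v)} + B₂·e^{−(κ′∕2)d(u,v)})·|f|`
# for `supp f ⊂ B(v)`, `x₀ ∈ B(u)`, `B₁ = (1 + p₂C_E√μ)·M·Σ_{l<k}λ^{−(l+1)}`, `B₂ = C₃·√(M·K_d(κ₁−κ′))·C_E·√μ` CLOSED-FORM IN THE DISPLAYED LETTERS, and the
# ROW SUM over the source blocks: `‖(G′(U)f)(x₀)‖ ≤ (B₁+B₂)·K_d(κ′∕2)·sup|f|` for EVERY `f` — the `L^∞ → L^∞` bound of `G′(U)`** — storey (D), item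
# (D-A) (the ASSEMBLY) of the NE9 owner's SUP-NORM PROGRAMME (plan v10 §5), composing BY NAME `B9Eq342SupNormBootstrapWeightedChain` (ne9-leaf-02 g71),
# `B9Eq342BlockDecayWeightedSum` (ne9-leaf-06 g70) and this lineage's Kato form of (3.23) (`B9Eq342GreenPrimeSupBound` ∕ `B9Eq323KatoDomination` §3)

statement-level skeleton of published theorems with citation tags; proofs where landed; nothing here is a claim about the Yang–Mills mass gap

CITATION HEADER (lean-in-tree rule).  Audit cell `pub-balaban`, sub-cell `t4`, BINDER row NE9; filed by the row OWNER lineage `b2b-balaban-t4-ne9-p1` (gen 90;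
plan v10 §5 (D-A), first refusal OWNER).  Source READ first-hand in the held text layer [Balaban1985BackgroundPropagators] (`paper:balaban1985-cmp99-background-propagators`,
journal page = PDF page + 388): p. 394 (3.23)–(3.25); p. 397 (3.39) *«|λ| = max sup|λ_μ(x)|»*, Thm 3.1 *«There exist positive constants M₁, δ₀, a₀, B₀
dependent on d and L only … the operator G′(U) (a = 1) satisfies the inequalities |(G′(U)λ)(x)|, … ≤ B₀ e^{−δ₀d(y,y′)} for x ∈ Δ(y), y ∈ Λ_j, supp λ ⊂ Δ(y′)
(3.42)»*; p. 399 (3.49) (the unit blocks `Δ(y)`); p. 415 *«random walk expansion»* (print's METHOD for the decay — NOT reproduced: the cell's substitute is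
positivity (Kato domination [DodziukMathai2006] §1, BY NAME through `B9Eq323KatoDomination`) + an Agmon∕Combes–Thomas supersolution weight (textbook METHOD,
Hislop–Sigal, *Introduction to Spectral Theory*, Ch. 3) + the chain's `L²` block decay).  NOTHING printed is used as a hypothesis; the `[cite: …]` tags are TEXT
LOCATIONS; every statement is `[folklore]` composition of DISPLAYED letters (ABSOLUTE RULE).

WHY THIS FILE.  `B9Eq342GreenPrimeSupBound.norm_GpOfU_apply_le` is (3.42)'s first entry WITHOUT `e^{−δ₀d(y,y′)}`; the (N)-reading of row NE9 consumes a
BLOCK SUP → SUP bound with summable decay (one row sum, `B11Eq115KernelOp.norm_kernelCLM_le_of_rowSum_le`).  Storey (D) supplies the decay from four letters,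
each inhabited (or being inhabited) level-free on the diagonal: the weight ((D-MP) `B5Eq129CoshSupersolution` + `B9Eq342CoshWeightBlockDistance`), the block-local
penalty ((D-P), ne9-leaf-03), the chain's `L²` block decay ((D-E), `B9Eq349ConjugatedGreenBlockDecay.exists_block_decay_Gp` in its window), the decayed free letter
((D-FS), `B5Eq129FreeResolventDecayedLetter` + `TSite` transport).  This file is the ASSEMBLY: all four displayed in the shapes those files print.

WHAT IS PROVED (sorry-free; 0 `def`).  Data as in `B9Eq342GreenPrimeSupBound` §1 (`TSite d (L·m)`, fibre `W ≃ 𝔸`, weight `c₀`, `U`, `η`, `a′`, `hpos′`), a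
(K1) block family `P_y` over `π = blockCoord` (`B9Eq349BlockMultipliers`), and the LETTERS: (T) contraction of the transporters; (D-P) `‖((Δ′_{a′}(U) − Δ^η_U)v)(x)‖
≤ p₂‖P_{πx}v‖`; (D-E) `‖P_y∘G′(U)∘P_v‖ ≤ C_E·e^{−κ·d_m(v,y)}`; (W) a weight `W > 0` on fine sites, `W(x₀) = 1`, supersolution `λW ≤ (L₀+1)W` (`L₀` the flat
`η⁻²`-stencil in the `Sum.elim unshift shift` shape) and domination `e^{κ₁d_m(πx₀,πx)} ≤ M·W(x)`; (D-FS) for every `k`-chain `φ₀, (L₀+1)φ_{j+1} = φ_j`: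
`φ_k(x₀) ≤ C₃·√(Σ_y c₀φ₀(y)²∕W(y))`; rates `0 ≤ κ′ ≤ κ`, `κ′ < κ₁`.
* §0 `block_apply_eq_self_of_support` (bookkeeping); **`kato_form_GpOfU`** — `G′(U)f` solves the Kato-form equation
  `Σ_j η⁻²(u(y) − T_{yj}u(nbr(y,j))) = f(y) − q(y)`, `q = (Δ′_{a′}(U) − Δ^η_U)u`, transporters `T = R(U⁻¹)(·−e_μ) ⊕ R(U)(·)` (the `hu` of every bootstrap).
* §1 **`norm_GpOfU_apply_le_decay`** — the two-rate form displayed in the title; **`norm_GpOfU_apply_le_decay'`** — one rate `κ′∕2`: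
  `‖(G′(U)f)(x₀)‖ ≤ (B₁ + B₂)·e^{−(κ′∕2)d_m(πx₀,v)}·F`.
* §2 **`norm_GpOfU_apply_le_rowSum`** — for EVERY `f` with `‖f(x)‖ ≤ F` and one-block masses `‖P_vf‖ ≤ √μF`: `‖(G′(U)f)(x₀)‖ ≤ (B₁+B₂)·K_d(κ′∕2)·F`
  (`f = Σ_v P_vf`, §1 per block, `B4Sect5Torus.torusSum_le`) — the `L^∞ → L^∞` bound, VOLUME-FREE; **`…_rowSum_unitary`** — (T) inhabited on the chain's class.
HONEST SCOPE.  Composition; the letters are HYPOTHESES (inhabited elsewhere: (T) here∕`B9Eq342GreenPrimeSupBound` §0; (D-E) by `exists_block_decay_Gp` on its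
window; (W) by the `cosh` weight files; (D-FS) on `Tor` by ne9-leaf-02's files, `TSite` transport pending; (D-P) by ne9-leaf-03's `B9Eq324PenaltyBlockLocal`,
pending); VALUE row only — no ∇-row, no Hölder norms; constants crude.  NOT summit progress (cell pub-balaban: NE9 NOT PRINTED ∕ NOT PROVED; «NE9 ⇐ the named
binders»; row WALLED ON A MODEL (O-NE9-1; #5 UNRULED); spine PROVED 0∕9; rung (B)+1 finite T⁴ — NOT infinite volume, NOT mass gap, NOT BetaPertH, NOT Clay).
HONEST DEPENDENCY (cell line): continuum YM on T⁴ ⇐ BetaPertH ∧ nine spine estimates (0/9 proved); BetaPertH ⇐ (D1) ∧ (D4) ∧ CAP+tail; G-an2-4 gates asym, D1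
and NE2/3/4.  NEW file importing `B9Eq342GreenPrimeSupBound` + `…SupNormBootstrapWeightedChain` + `…BlockDecayWeightedSum`; nothing modified.  Net new unproved facts: 0.
-/

noncomputable section

open scoped InnerProductSpace ComplexConjugate BigOperators

namespace Literature.MathematicalPhysics.QuantumFieldTheory.Balaban1983to89.B9Eq342GreenPrimeSupBoundDecay

open B4Sect5Torus (TSite tdist tdist_nonneg torusSum_le)
open B4Sect5Proof (latticeConst latticeConst_nonneg)
open B9SectCLatticeCarrier (Bond shift unshift)
open B9Eq319QprimeTorus (fineP blockCoord)
open B9Eq311L2Pairing (WL2)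
open B11Eq103H1Complex (SiteL2K covLaplaceSiteK apply_greenK)
open B9Eq310HessianOperator (adTransportW)
open B9Eq3119DeltaPiCarrier (laplacePrimeA GpOfU)
open B9Eq323KatoDomination (equiv_covLaplaceSiteK_eq_sum)
open B9Eq349BlockMultipliers (sum_block_apply)
open B9Eq342GreenPrimeSupBound (adTransportW_inv_adTransportW norm_adTransportW_eq norm_adTransportW_inv_eq)
open B9Eq342SupNormBootstrapWeightedChain (exists_scalar_chain norm_le_of_kato_bootstrap_weighted_chain_centre)
open B9Eq342BlockDecayWeightedSum (norm_block_apply_le_of_block_decay norm_apply_le_weight_of_support_lattice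
  norm_block_apply_le_weight_lattice weighted_sum_norm_sq_le_of_block_decay_op_lattice)

variable {d : ℕ} (L : ℕ) [NeZero L] (m : Fin d → ℕ) {𝔸 : Type*} [Ring 𝔸] [StarRing 𝔸] [Algebra ℂ 𝔸] [StarModule ℂ 𝔸]
  {W : Type*} [NormedAddCommGroup W] [InnerProductSpace ℂ W] [FiniteDimensional ℂ W] (φ : W ≃ₗ[ℂ] 𝔸) {c₀ : ℝ} [Fact (0 < c₀)]
  (η : ℝ) (U : Bond d (fineP L m) → 𝔸ˣ) {c₁ : ℝ} [Fact (0 < c₁)] (a' : ℝ)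
  (hpos' : ∀ x : SiteL2K ℂ d (fineP L m) c₀ W, x ≠ 0 → 0 < RCLike.re ⟪x, laplacePrimeA L m φ η U a' (c₁ := c₁) x⟫_ℂ)

/-! ## §0 Bookkeeping: one-block sources, and `G′(U)f` in Kato form -/

omit [NeZero L] [FiniteDimensional ℂ W] [Fact (0 < c₀)] in
/-- the identification commutes with finite sums, pointwise (private helper). [folklore] -/
private theorem equiv_sum {ι : Type*} (s : Finset ι) (g : ι → SiteL2K ℂ d (fineP L m) c₀ W) (x : TSite d (fineP L m)) :
    WL2.equiv ℂ _ W (∑ i ∈ s, g i) x = ∑ i ∈ s, WL2.equiv ℂ _ W (g i) x := by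
  have e := congrFun (map_sum (WL2.linearEquiv ℂ ℂ (fun _ : TSite d (fineP L m) => c₀) (V := W)) g s) x
  simp only [WL2.linearEquiv_apply, Finset.sum_apply] at e
  exact e

omit [NeZero L] [FiniteDimensional ℂ W] in
/-- **A ONE-BLOCK SOURCE IS FIXED BY ITS BLOCK PROJECTION**: `f(x) = 0` off `B(v)` ⟹ `P_v f = f` (print's «supp λ ⊂ Δ(y′)» read in the (K1) block currency of
`B9Eq349BlockMultipliers`). [cite: Balaban1985BackgroundPropagators, Thm 3.1 (3.42) p.397, (3.49) p.399] -/
theorem block_apply_eq_self_of_support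
    {PS : TSite d m → SiteL2K ℂ d (fineP L m) c₀ W →L[ℂ] SiteL2K ℂ d (fineP L m) c₀ W}
    (hPS : ∀ (y : TSite d m) (g : SiteL2K ℂ d (fineP L m) c₀ W) (x : TSite d (fineP L m)),
      WL2.equiv ℂ (fun _ : TSite d (fineP L m) => c₀) W (PS y g) x =
        if blockCoord L m x = y then WL2.equiv ℂ (fun _ : TSite d (fineP L m) => c₀) W g x else 0)
    {v : TSite d m} {f : SiteL2K ℂ d (fineP L m) c₀ W} (hfv : ∀ x, blockCoord L m x ≠ v → WL2.equiv ℂ _ W f x = 0) :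
    PS v f = f := by
  apply (WL2.equiv ℂ (fun _ : TSite d (fineP L m) => c₀) W).injective
  funext x
  rw [hPS]
  by_cases hx : blockCoord L m x = v
  · rw [if_pos hx]
  · rw [if_neg hx, hfv x hx]

omit [StarRing 𝔸] [StarModule ℂ 𝔸] in
/-- **`G′(U)f` IN KATO FORM** (the `hu` of every bootstrap of the programme, exported): with `u = G′(U)f`, `q = (Δ′_{a′}(U) − Δ^η_U)u = a′Q′(U)†Q′(U)u` and the
transporters `T_{y,μ} = R(U(y−e_μ,μ)⁻¹)` on the backward, `R(U(y,μ))` on the forward neighbours: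
`Σ_{j ∈ Fin d ⊕ Fin d} η⁻²·(u(y) − T_{yj}u(nbr(y,j))) = f(y) − q(y)` — (3.23) `Δ^η_U = D*_U D_U` in the weighted-graph form of `B9Eq323KatoDomination` §3 and
`Δ′_{a′}(U)u = f`. [cite: Balaban1985BackgroundPropagators, (3.23)–(3.25) p.394] -/
theorem kato_form_GpOfU (f : SiteL2K ℂ d (fineP L m) c₀ W) (y : TSite d (fineP L m)) :
    ∑ j : Fin d ⊕ Fin d, (RCLike.ofReal ((η⁻¹) ^ 2) : ℂ) •
        (WL2.equiv ℂ _ W (GpOfU L m φ η U a' hpos' f) y -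
          (Sum.elim (fun μ => adTransportW φ (fun b => (U b)⁻¹) (unshift μ y, μ)) (fun μ => adTransportW φ U (y, μ)) j :
              W →ₗ[ℂ] W)
            (WL2.equiv ℂ _ W (GpOfU L m φ η U a' hpos' f) (Sum.elim (fun μ => unshift μ y) (fun μ => shift μ y) j))) =
      WL2.equiv ℂ _ W f y -
        WL2.equiv ℂ _ W (laplacePrimeA L m φ η U a' (c₁ := c₁) (GpOfU L m φ η U a' hpos' f) -
          covLaplaceSiteK ((η : ℂ))⁻¹ (adTransportW φ U) (adTransportW φ fun b => (U b)⁻¹) (GpOfU L m φ η U a' hpos' f)) y := by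
  set u : SiteL2K ℂ d (fineP L m) c₀ W := GpOfU L m φ η U a' hpos' f with hu_def
  set q : SiteL2K ℂ d (fineP L m) c₀ W := laplacePrimeA L m φ η U a' (c₁ := c₁) u -
    covLaplaceSiteK ((η : ℂ))⁻¹ (adTransportW φ U) (adTransportW φ fun b => (U b)⁻¹) u with hq_def
  have hsol : laplacePrimeA L m φ η U a' (c₁ := c₁) u = f := by rw [hu_def]; exact apply_greenK hpos' f
  have hsplit : covLaplaceSiteK ((η : ℂ))⁻¹ (adTransportW φ U) (adTransportW φ fun b => (U b)⁻¹) u = f - q := by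
    rw [hq_def, hsol]; abel
  have hcast : ((η : ℂ))⁻¹ = (RCLike.ofReal (η⁻¹) : ℂ) := (Complex.ofReal_inv η).symm
  rw [hcast] at hsplit
  have h := congr_arg (fun g => WL2.equiv ℂ _ W g y) hsplit
  simp only [WL2.equiv_sub, Pi.sub_apply] at h
  rw [equiv_covLaplaceSiteK_eq_sum (η⁻¹) _ _ (adTransportW_inv_adTransportW φ U) u y] at h
  rw [← h, Fintype.sum_sum_type, ← Finset.sum_add_distrib]
  refine Finset.sum_congr rfl fun μ _ => ?_
  rw [← smul_add]; rfl

/-! ## §1 (3.42), first entry WITH DECAY, for `G′(U)` and a one-block source -/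

omit [StarRing 𝔸] [StarModule ℂ 𝔸] in
/-- **THE VALUE ROW OF (3.42) WITH ITS DECAY FACTOR, AT THE TOP LEVEL, FOR PRINT's `G′(U)` — TWO-RATE CLOSED FORM.**  Letters: (T) contractive transporters;
(D-P) the BLOCK-LOCAL penalty `‖((Δ′_{a′}(U) − Δ^η_U)v)(x)‖ ≤ p₂‖P_{πx}v‖`; (D-E) the block decay `‖P_y∘G′(U)∘P_v‖ ≤ C_E·e^{−κd_m(v,y)}` of the source
block `v`; (W) a weight `W > 0` with `W(x₀) = 1`, supersolution `λW ≤ (L₀+1)W` for the flat `η⁻²`-stencil, and domination `e^{κ₁d_m(πx₀,πx)} ≤ M·W(x)`;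
(D-FS) the decayed free letter at `x₀` against `W` with constant `C₃` for `k`-chains; rates `0 ≤ κ′ ≤ κ`, `κ′ < κ₁`; data `f` supported in `B(v)` with
`‖f(y)‖ ≤ F`, `‖f‖ ≤ √μF`.  Then
`‖(G′(U)f)(x₀)‖ ≤ ((1 + p₂C_E√μ)·M·(Σ_{l<k}λ^{−(l+1)})·e^{−κ′d_m(πx₀,v)} + C₃·√(M·K_d(κ₁−κ′))·C_E·√μ·e^{−(κ′∕2)d_m(πx₀,v)})·F`
— Kato domination `k+1` times against the weight, the data term through (D-P)+(D-E)+support, the free term through (D-FS) and the decaying bracket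
`Σ_y c₀‖u(y)‖²∕W(y) ≤ M(C_E‖f‖)²K_d e^{−κ′d}`. [cite: Balaban1985BackgroundPropagators, Thm 3.1 (3.42) p.397, (3.24)–(3.25) p.394, (3.49) p.399] -/
theorem norm_GpOfU_apply_le_decay (hm : ∀ i, 1 ≤ m i)
    (hR : ∀ b w, ‖adTransportW φ U b w‖ ≤ ‖w‖) (hS : ∀ b w, ‖adTransportW φ (fun b => (U b)⁻¹) b w‖ ≤ ‖w‖)
    {PS : TSite d m → SiteL2K ℂ d (fineP L m) c₀ W →L[ℂ] SiteL2K ℂ d (fineP L m) c₀ W}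
    (hPS : ∀ (y : TSite d m) (g : SiteL2K ℂ d (fineP L m) c₀ W) (x : TSite d (fineP L m)),
      WL2.equiv ℂ (fun _ : TSite d (fineP L m) => c₀) W (PS y g) x =
        if blockCoord L m x = y then WL2.equiv ℂ (fun _ : TSite d (fineP L m) => c₀) W g x else 0)
    {p₂ CE C₃ M lam κ κ₁ κ' : ℝ} (hp₂ : 0 ≤ p₂) (hCE : 0 ≤ CE) (hC₃ : 0 ≤ C₃) (hM : 0 ≤ M) (hlam : 0 < lam)
    (hκ' : 0 ≤ κ') (hκ : κ' ≤ κ) (hκ₁ : κ' < κ₁)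
    (hP : ∀ (v : SiteL2K ℂ d (fineP L m) c₀ W) (x : TSite d (fineP L m)),
      ‖WL2.equiv ℂ _ W (laplacePrimeA L m φ η U a' (c₁ := c₁) v -
        covLaplaceSiteK ((η : ℂ))⁻¹ (adTransportW φ U) (adTransportW φ fun b => (U b)⁻¹) v) x‖ ≤ p₂ * ‖PS (blockCoord L m x) v‖)
    {v : TSite d m}
    (hdec : ∀ y : TSite d m, ‖PS y ∘L LinearMap.toContinuousLinearMap (GpOfU L m φ η U a' hpos') ∘L PS v‖ ≤
      CE * Real.exp (-(κ * tdist m v y)))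
    {x₀ : TSite d (fineP L m)} {Wt : TSite d (fineP L m) → ℝ} (hW0 : ∀ x, 0 < Wt x) (hx₀ : Wt x₀ = 1) (hsup : ∀ x, lam * Wt x ≤
      ∑ j : Fin d ⊕ Fin d, (η⁻¹) ^ 2 * (Wt x - Wt (Sum.elim (fun μ => unshift μ x) (fun μ => shift μ x) j)) + 1 * Wt x)
    (hWd : ∀ x, Real.exp (κ₁ * tdist m (blockCoord L m x₀) (blockCoord L m x)) ≤ M * Wt x) {k : ℕ}
    (hDFS : ∀ ψ : ℕ → TSite d (fineP L m) → ℝ, (∀ j < k, ∀ x, ∑ i : Fin d ⊕ Fin d,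
        (η⁻¹) ^ 2 * (ψ (j + 1) x - ψ (j + 1) (Sum.elim (fun μ => unshift μ x) (fun μ => shift μ x) i)) + 1 * ψ (j + 1) x = ψ j x) →
      ψ k x₀ ≤ C₃ * Real.sqrt (∑ y, c₀ * ψ 0 y ^ 2 / Wt y))
    (f : SiteL2K ℂ d (fineP L m) c₀ W) (hfv : ∀ x, blockCoord L m x ≠ v → WL2.equiv ℂ _ W f x = 0)
    {F μ : ℝ} (hF : ∀ y, ‖WL2.equiv ℂ _ W f y‖ ≤ F) (hμ : ‖f‖ ≤ Real.sqrt μ * F) :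
    ‖WL2.equiv ℂ _ W (GpOfU L m φ η U a' hpos' f) x₀‖ ≤
      ((1 + p₂ * CE * Real.sqrt μ) * M * (∑ l ∈ Finset.range k, (lam ^ (l + 1))⁻¹) *
          Real.exp (-(κ' * tdist m (blockCoord L m x₀) v)) +
        C₃ * Real.sqrt (M * latticeConst d (κ₁ - κ')) * CE * Real.sqrt μ *
          Real.exp (-(κ' / 2 * tdist m (blockCoord L m x₀) v))) * F := by
  -- the solution, the penalty term, the Kato form
  set u : SiteL2K ℂ d (fineP L m) c₀ W := GpOfU L m φ η U a' hpos' f with hu_def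
  set q : SiteL2K ℂ d (fineP L m) c₀ W := laplacePrimeA L m φ η U a' (c₁ := c₁) u -
    covLaplaceSiteK ((η : ℂ))⁻¹ (adTransportW φ U) (adTransportW φ fun b => (U b)⁻¹) u with hq_def
  let nbr : TSite d (fineP L m) → Fin d ⊕ Fin d → TSite d (fineP L m) := fun y j => Sum.elim (fun μ => unshift μ y) (fun μ => shift μ y) j
  let T : TSite d (fineP L m) → Fin d ⊕ Fin d → W →ₗ[ℂ] W :=
    fun y j => Sum.elim (fun μ => adTransportW φ (fun b => (U b)⁻¹) (unshift μ y, μ)) (fun μ => adTransportW φ U (y, μ)) j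
  have hT : ∀ y j w, ‖T y j w‖ ≤ ‖w‖ := fun y j w => by rcases j with μ | μ; exacts [hS _ w, hR _ w]
  have hu : ∀ y, ∑ j, (RCLike.ofReal ((fun (_ : TSite d (fineP L m)) (_ : Fin d ⊕ Fin d) => (η⁻¹) ^ 2) y j) : ℂ) •
      (WL2.equiv ℂ _ W u y - T y j (WL2.equiv ℂ _ W u (nbr y j))) = WL2.equiv ℂ _ W f y - WL2.equiv ℂ _ W q y :=
    fun y => kato_form_GpOfU L m φ η U a' hpos' (c₁ := c₁) f y
  set u₀ : TSite d m := blockCoord L m x₀ with hu₀_def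
  set E : ℝ := Real.exp (-(κ' * tdist m u₀ v)) with hE_def
  have hE0 : 0 < E := Real.exp_pos _
  have hF0 : 0 ≤ F := (norm_nonneg _).trans (hF x₀)
  have hW0' : ∀ x, 0 ≤ Wt x := fun x => (hW0 x).le
  have hfμ : CE * ‖f‖ ≤ CE * (Real.sqrt μ * F) := mul_le_mul_of_nonneg_left hμ hCE
  have hWκ' : ∀ x, Real.exp (κ' * tdist m u₀ (blockCoord L m x)) ≤ M * Wt x := fun x =>
    (Real.exp_le_exp.2 (mul_le_mul_of_nonneg_right hκ₁.le (tdist_nonneg m _ _))).trans (hWd x)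
  -- (D-E): block decay of `u = G′(U)f` away from the source block
  have hfix : PS v f = f := block_apply_eq_self_of_support L m hPS hfv
  have hblk : ∀ y : TSite d m, ‖PS y u‖ ≤ CE * ‖f‖ * Real.exp (-(κ * tdist m v y)) := fun y => by
    have h := norm_block_apply_le_of_block_decay (δ := fun a b => tdist m b a)
      (LinearMap.toContinuousLinearMap (GpOfU L m φ η U a' hpos')) hfix hdec y
    calc ‖PS y u‖ = ‖PS y (LinearMap.toContinuousLinearMap (GpOfU L m φ η U a' hpos') f)‖ := rfl
      _ ≤ CE * Real.exp (-(κ * tdist m v y)) * ‖f‖ := h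
      _ = CE * ‖f‖ * Real.exp (-(κ * tdist m v y)) := by ring
  -- the DATA against the weight: `‖f y‖ + ‖q y‖ ≤ s·λ·W y`
  have hfy : ∀ y, ‖WL2.equiv ℂ _ W f y‖ ≤ F * M * E * Wt y := fun y =>
    norm_apply_le_weight_of_support_lattice (𝕜 := ℂ) hfv hF0 hF u₀ hW0' hM hWκ' y
  have hqy : ∀ y, ‖WL2.equiv ℂ _ W q y‖ ≤ p₂ * (CE * ‖f‖ * M * E * Wt y) := fun y =>
    (hP u y).trans (mul_le_mul_of_nonneg_left
      (norm_block_apply_le_weight_lattice (𝕜 := ℂ) hm (mul_nonneg hCE (norm_nonneg _)) hblk u₀ hκ' hκ hWκ' y) hp₂)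
  set s : ℝ := (1 + p₂ * CE * Real.sqrt μ) * F * M * E / lam with hs_def
  have hs : 0 ≤ s := by positivity
  have hdata : ∀ y, ‖WL2.equiv ℂ _ W f y‖ + ‖WL2.equiv ℂ _ W q y‖ ≤ s * (lam * Wt y) := fun y => by
    have h3 : p₂ * (CE * ‖f‖ * M * E * Wt y) ≤ p₂ * (CE * (Real.sqrt μ * F) * M * E * Wt y) :=
      mul_le_mul_of_nonneg_left (mul_le_mul_of_nonneg_right (mul_le_mul_of_nonneg_right
        (mul_le_mul_of_nonneg_right hfμ hM) hE0.le) (hW0' y)) hp₂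
    have e : s * (lam * Wt y) = F * M * E * Wt y + p₂ * (CE * (Real.sqrt μ * F) * M * E * Wt y) := by
      calc s * (lam * Wt y) = (1 + p₂ * CE * Real.sqrt μ) * F * M * E * (lam / lam) * Wt y := by rw [hs_def]; ring
        _ = F * M * E * Wt y + p₂ * (CE * (Real.sqrt μ * F) * M * E * Wt y) := by rw [div_self hlam.ne']; ring
    rw [e]; linarith [hfy y, hqy y]
  -- the free chain from `‖u‖`
  obtain ⟨ψ, hψ0, hψ⟩ := exists_scalar_chain nbr (fun _ _ => (η⁻¹) ^ 2) (fun _ _ => sq_nonneg _) one_pos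
    (fun y => ‖WL2.equiv ℂ _ W u y‖) k
  -- THE WEIGHTED BOOTSTRAP at the centre
  have hboot := norm_le_of_kato_bootstrap_weighted_chain_centre (𝕜 := ℂ) nbr (fun _ _ => (η⁻¹) ^ 2) (fun _ _ => sq_nonneg _)
    T hT one_pos hlam hsup hu hs hdata (fun y => by rw [hψ0]) hψ hx₀
  -- (D-FS) + the decaying bracket
  have hbr := weighted_sum_norm_sq_le_of_block_decay_op_lattice (𝕜 := ℂ) (P := PS) hPS hm
    (LinearMap.toContinuousLinearMap (GpOfU L m φ η U a' hpos')) hfix hdec u₀ hW0 hM hWd hκ' hκ₁ (by linarith)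
  have hKnn : 0 ≤ latticeConst d (κ₁ - κ') := latticeConst_nonneg d (by linarith)
  have hψk : ψ k x₀ ≤ C₃ * Real.sqrt (M * latticeConst d (κ₁ - κ')) * CE * Real.sqrt μ * Real.exp (-(κ' / 2 * tdist m u₀ v)) * F := by
    have h1 := hDFS ψ hψ
    have hsum : ∑ y, c₀ * ψ 0 y ^ 2 / Wt y ≤ M * (CE * ‖f‖) ^ 2 * latticeConst d (κ₁ - κ') * E := by
      have e : ∀ y, c₀ * ψ 0 y ^ 2 / Wt y = c₀ * ‖WL2.equiv ℂ (fun _ : TSite d (fineP L m) => c₀) W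
          (LinearMap.toContinuousLinearMap (GpOfU L m φ η U a' hpos') f) y‖ ^ 2 / Wt y := fun y => by rw [hψ0]; rfl
      rw [Finset.sum_congr rfl fun y _ => e y]
      exact hbr
    have hEhalf : Real.sqrt E = Real.exp (-(κ' / 2 * tdist m u₀ v)) := by
      rw [hE_def, show -(κ' * tdist m u₀ v) = -(κ' / 2 * tdist m u₀ v) + -(κ' / 2 * tdist m u₀ v) by ring, Real.exp_add,
        Real.sqrt_mul_self (Real.exp_pos _).le]
    have hy0 : 0 ≤ Real.sqrt (M * latticeConst d (κ₁ - κ')) * (CE * (Real.sqrt μ * F)) * Real.sqrt E := by positivity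
    have hsq : M * (CE * ‖f‖) ^ 2 * latticeConst d (κ₁ - κ') * E ≤
        (Real.sqrt (M * latticeConst d (κ₁ - κ')) * (CE * (Real.sqrt μ * F)) * Real.sqrt E) ^ 2 := by
      have e2 : (Real.sqrt (M * latticeConst d (κ₁ - κ')) * (CE * (Real.sqrt μ * F)) * Real.sqrt E) ^ 2 =
          M * latticeConst d (κ₁ - κ') * (CE * (Real.sqrt μ * F)) ^ 2 * E := by
        rw [mul_pow, mul_pow, Real.sq_sqrt (mul_nonneg hM hKnn), Real.sq_sqrt hE0.le]
      rw [e2]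
      have h2 : (CE * ‖f‖) ^ 2 ≤ (CE * (Real.sqrt μ * F)) ^ 2 := pow_le_pow_left₀ (mul_nonneg hCE (norm_nonneg _)) hfμ 2
      have h3 : 0 ≤ M * latticeConst d (κ₁ - κ') * E := by positivity
      nlinarith
    have hroot : Real.sqrt (∑ y, c₀ * ψ 0 y ^ 2 / Wt y) ≤
        Real.sqrt (M * latticeConst d (κ₁ - κ')) * (CE * (Real.sqrt μ * F)) * Real.sqrt E :=
      Real.sqrt_le_iff.2 ⟨hy0, hsum.trans hsq⟩
    calc ψ k x₀ ≤ C₃ * Real.sqrt (∑ y, c₀ * ψ 0 y ^ 2 / Wt y) := h1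
      _ ≤ C₃ * (Real.sqrt (M * latticeConst d (κ₁ - κ')) * (CE * (Real.sqrt μ * F)) * Real.sqrt E) := mul_le_mul_of_nonneg_left hroot hC₃
      _ = C₃ * Real.sqrt (M * latticeConst d (κ₁ - κ')) * CE * Real.sqrt μ * Real.exp (-(κ' / 2 * tdist m u₀ v)) * F := by
          rw [hEhalf]; ring
  -- assemble
  have hgeom : s * ∑ l ∈ Finset.range k, (1 / lam) ^ l =
      (1 + p₂ * CE * Real.sqrt μ) * M * (∑ l ∈ Finset.range k, (lam ^ (l + 1))⁻¹) * E * F := by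
    rw [hs_def, Finset.mul_sum, Finset.mul_sum, Finset.sum_mul, Finset.sum_mul]
    refine Finset.sum_congr rfl fun l _ => ?_
    rw [one_div, inv_pow, pow_succ, mul_inv]
    field_simp
  calc ‖WL2.equiv ℂ _ W u x₀‖ ≤ s * ∑ l ∈ Finset.range k, (1 / lam) ^ l + 1 ^ k * ψ k x₀ := hboot
    _ = (1 + p₂ * CE * Real.sqrt μ) * M * (∑ l ∈ Finset.range k, (lam ^ (l + 1))⁻¹) * E * F + ψ k x₀ := by rw [hgeom, one_pow, one_mul]
    _ ≤ (1 + p₂ * CE * Real.sqrt μ) * M * (∑ l ∈ Finset.range k, (lam ^ (l + 1))⁻¹) * E * F +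
          C₃ * Real.sqrt (M * latticeConst d (κ₁ - κ')) * CE * Real.sqrt μ * Real.exp (-(κ' / 2 * tdist m u₀ v)) * F := by
        linarith [hψk]
    _ = _ := by rw [hE_def]; ring

omit [StarRing 𝔸] [StarModule ℂ 𝔸] in
/-- **… ONE-RATE FORM**: `‖(G′(U)f)(x₀)‖ ≤ (B₁ + B₂)·e^{−(κ′∕2)·d_m(πx₀,v)}·F` with `B₁ = (1 + p₂C_E√μ)·M·Σ_{l<k}λ^{−(l+1)}`,
`B₂ = C₃·√(M·K_d(κ₁−κ′))·C_E·√μ` — print's «|(G′(U)λ)(x)| ≤ B₀e^{−δ₀d(y,y′)}|λ| for x ∈ Δ(y), supp λ ⊂ Δ(y′)» at `L^jη = 1`, `δ₀ = κ′∕2`, for EVERY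
background with contractive transporters, modulo the displayed letters. [cite: Balaban1985BackgroundPropagators, Thm 3.1 (3.42) p.397] -/
theorem norm_GpOfU_apply_le_decay' (hm : ∀ i, 1 ≤ m i)
    (hR : ∀ b w, ‖adTransportW φ U b w‖ ≤ ‖w‖) (hS : ∀ b w, ‖adTransportW φ (fun b => (U b)⁻¹) b w‖ ≤ ‖w‖)
    {PS : TSite d m → SiteL2K ℂ d (fineP L m) c₀ W →L[ℂ] SiteL2K ℂ d (fineP L m) c₀ W}
    (hPS : ∀ (y : TSite d m) (g : SiteL2K ℂ d (fineP L m) c₀ W) (x : TSite d (fineP L m)),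
      WL2.equiv ℂ (fun _ : TSite d (fineP L m) => c₀) W (PS y g) x =
        if blockCoord L m x = y then WL2.equiv ℂ (fun _ : TSite d (fineP L m) => c₀) W g x else 0)
    {p₂ CE C₃ M lam κ κ₁ κ' : ℝ} (hp₂ : 0 ≤ p₂) (hCE : 0 ≤ CE) (hC₃ : 0 ≤ C₃) (hM : 0 ≤ M) (hlam : 0 < lam)
    (hκ' : 0 ≤ κ') (hκ : κ' ≤ κ) (hκ₁ : κ' < κ₁)
    (hP : ∀ (v : SiteL2K ℂ d (fineP L m) c₀ W) (x : TSite d (fineP L m)),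
      ‖WL2.equiv ℂ _ W (laplacePrimeA L m φ η U a' (c₁ := c₁) v -
        covLaplaceSiteK ((η : ℂ))⁻¹ (adTransportW φ U) (adTransportW φ fun b => (U b)⁻¹) v) x‖ ≤ p₂ * ‖PS (blockCoord L m x) v‖)
    {v : TSite d m}
    (hdec : ∀ y : TSite d m, ‖PS y ∘L LinearMap.toContinuousLinearMap (GpOfU L m φ η U a' hpos') ∘L PS v‖ ≤
      CE * Real.exp (-(κ * tdist m v y)))
    {x₀ : TSite d (fineP L m)} {Wt : TSite d (fineP L m) → ℝ} (hW0 : ∀ x, 0 < Wt x) (hx₀ : Wt x₀ = 1) (hsup : ∀ x, lam * Wt x ≤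
      ∑ j : Fin d ⊕ Fin d, (η⁻¹) ^ 2 * (Wt x - Wt (Sum.elim (fun μ => unshift μ x) (fun μ => shift μ x) j)) + 1 * Wt x)
    (hWd : ∀ x, Real.exp (κ₁ * tdist m (blockCoord L m x₀) (blockCoord L m x)) ≤ M * Wt x) {k : ℕ}
    (hDFS : ∀ ψ : ℕ → TSite d (fineP L m) → ℝ, (∀ j < k, ∀ x, ∑ i : Fin d ⊕ Fin d,
        (η⁻¹) ^ 2 * (ψ (j + 1) x - ψ (j + 1) (Sum.elim (fun μ => unshift μ x) (fun μ => shift μ x) i)) + 1 * ψ (j + 1) x = ψ j x) →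
      ψ k x₀ ≤ C₃ * Real.sqrt (∑ y, c₀ * ψ 0 y ^ 2 / Wt y))
    (f : SiteL2K ℂ d (fineP L m) c₀ W) (hfv : ∀ x, blockCoord L m x ≠ v → WL2.equiv ℂ _ W f x = 0)
    {F μ : ℝ} (hF : ∀ y, ‖WL2.equiv ℂ _ W f y‖ ≤ F) (hμ : ‖f‖ ≤ Real.sqrt μ * F) :
    ‖WL2.equiv ℂ _ W (GpOfU L m φ η U a' hpos' f) x₀‖ ≤
      ((1 + p₂ * CE * Real.sqrt μ) * M * (∑ l ∈ Finset.range k, (lam ^ (l + 1))⁻¹) +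
        C₃ * Real.sqrt (M * latticeConst d (κ₁ - κ')) * CE * Real.sqrt μ) *
        Real.exp (-(κ' / 2 * tdist m (blockCoord L m x₀) v)) * F := by
  have h := norm_GpOfU_apply_le_decay L m φ η U a' hpos' (c₁ := c₁) hm hR hS hPS hp₂ hCE hC₃ hM hlam hκ' hκ hκ₁ hP hdec hW0 hx₀ hsup
    hWd hDFS f hfv hF hμ
  have hF0 : 0 ≤ F := (norm_nonneg _).trans (hF x₀)
  have hexp : Real.exp (-(κ' * tdist m (blockCoord L m x₀) v)) ≤ Real.exp (-(κ' / 2 * tdist m (blockCoord L m x₀) v)) :=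
    Real.exp_le_exp.2 (by nlinarith [tdist_nonneg m (blockCoord L m x₀) v])
  have hA : 0 ≤ (1 + p₂ * CE * Real.sqrt μ) * M * (∑ l ∈ Finset.range k, (lam ^ (l + 1))⁻¹) :=
    mul_nonneg (mul_nonneg (by positivity) hM) (Finset.sum_nonneg fun l _ => inv_nonneg.2 (pow_nonneg hlam.le _))
  have h1 := mul_le_mul_of_nonneg_left hexp hA
  nlinarith [h1, hF0]

/-! ## §2 The row sum over the source blocks: the `L^∞ → L^∞` bound of `G′(U)` -/

omit [StarRing 𝔸] [StarModule ℂ 𝔸] in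
/-- **THE ROW SUM OF (3.42): `‖(G′(U)f)(x₀)‖ ≤ (B₁ + B₂)·K_d(κ′∕2)·sup|f|` FOR EVERY `f`** (no support hypothesis): decompose `f = Σ_v P_vf` (the blocks
partition the lattice, `B9Eq349BlockMultipliers.sum_block_apply`), apply §1 to each one-block piece (`‖(P_vf)(x)‖ ≤ F`, one-block masses `‖P_vf‖ ≤ √μF` —
the letter `hμ`, `μ = c₀L^d` by counting), and sum the decay factors with `B4Sect5Torus.torusSum_le` (`Σ_v e^{−(κ′∕2)d_m(πx₀,v)} ≤ K_d(κ′∕2)`, VOLUME-FREE;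
`0 < κ′`).  This is the `L^∞`-OPERATOR-NORM form in which the (N)-reading consumes the value row (`B11Eq115KernelOp.norm_kernelCLM_le_of_rowSum_le`).
[cite: Balaban1985BackgroundPropagators, Thm 3.1 (3.42) p.397, (3.39) p.397, (3.49) p.399] -/
theorem norm_GpOfU_apply_le_rowSum (hm : ∀ i, 1 ≤ m i)
    (hR : ∀ b w, ‖adTransportW φ U b w‖ ≤ ‖w‖) (hS : ∀ b w, ‖adTransportW φ (fun b => (U b)⁻¹) b w‖ ≤ ‖w‖)
    {PS : TSite d m → SiteL2K ℂ d (fineP L m) c₀ W →L[ℂ] SiteL2K ℂ d (fineP L m) c₀ W}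
    (hPS : ∀ (y : TSite d m) (g : SiteL2K ℂ d (fineP L m) c₀ W) (x : TSite d (fineP L m)),
      WL2.equiv ℂ (fun _ : TSite d (fineP L m) => c₀) W (PS y g) x =
        if blockCoord L m x = y then WL2.equiv ℂ (fun _ : TSite d (fineP L m) => c₀) W g x else 0)
    {p₂ CE C₃ M lam κ κ₁ κ' : ℝ} (hp₂ : 0 ≤ p₂) (hCE : 0 ≤ CE) (hC₃ : 0 ≤ C₃) (hM : 0 ≤ M) (hlam : 0 < lam)
    (hκ' : 0 < κ') (hκ : κ' ≤ κ) (hκ₁ : κ' < κ₁)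
    (hP : ∀ (v : SiteL2K ℂ d (fineP L m) c₀ W) (x : TSite d (fineP L m)),
      ‖WL2.equiv ℂ _ W (laplacePrimeA L m φ η U a' (c₁ := c₁) v -
        covLaplaceSiteK ((η : ℂ))⁻¹ (adTransportW φ U) (adTransportW φ fun b => (U b)⁻¹) v) x‖ ≤ p₂ * ‖PS (blockCoord L m x) v‖)
    (hdec : ∀ v y : TSite d m, ‖PS y ∘L LinearMap.toContinuousLinearMap (GpOfU L m φ η U a' hpos') ∘L PS v‖ ≤
      CE * Real.exp (-(κ * tdist m v y)))
    {x₀ : TSite d (fineP L m)} {Wt : TSite d (fineP L m) → ℝ} (hW0 : ∀ x, 0 < Wt x) (hx₀ : Wt x₀ = 1) (hsup : ∀ x, lam * Wt x ≤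
      ∑ j : Fin d ⊕ Fin d, (η⁻¹) ^ 2 * (Wt x - Wt (Sum.elim (fun μ => unshift μ x) (fun μ => shift μ x) j)) + 1 * Wt x)
    (hWd : ∀ x, Real.exp (κ₁ * tdist m (blockCoord L m x₀) (blockCoord L m x)) ≤ M * Wt x) {k : ℕ}
    (hDFS : ∀ ψ : ℕ → TSite d (fineP L m) → ℝ, (∀ j < k, ∀ x, ∑ i : Fin d ⊕ Fin d,
        (η⁻¹) ^ 2 * (ψ (j + 1) x - ψ (j + 1) (Sum.elim (fun μ => unshift μ x) (fun μ => shift μ x) i)) + 1 * ψ (j + 1) x = ψ j x) →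
      ψ k x₀ ≤ C₃ * Real.sqrt (∑ y, c₀ * ψ 0 y ^ 2 / Wt y))
    (f : SiteL2K ℂ d (fineP L m) c₀ W) {F μ : ℝ} (hF : ∀ y, ‖WL2.equiv ℂ _ W f y‖ ≤ F) (hμ : ∀ v, ‖PS v f‖ ≤ Real.sqrt μ * F) :
    ‖WL2.equiv ℂ _ W (GpOfU L m φ η U a' hpos' f) x₀‖ ≤
      ((1 + p₂ * CE * Real.sqrt μ) * M * (∑ l ∈ Finset.range k, (lam ^ (l + 1))⁻¹) +
        C₃ * Real.sqrt (M * latticeConst d (κ₁ - κ')) * CE * Real.sqrt μ) * latticeConst d (κ' / 2) * F := by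
  classical
  set B : ℝ := (1 + p₂ * CE * Real.sqrt μ) * M * (∑ l ∈ Finset.range k, (lam ^ (l + 1))⁻¹) +
    C₃ * Real.sqrt (M * latticeConst d (κ₁ - κ')) * CE * Real.sqrt μ with hB_def
  have hF0 : 0 ≤ F := (norm_nonneg _).trans (hF x₀)
  have hB0 : 0 ≤ B :=
    add_nonneg (mul_nonneg (mul_nonneg (by positivity) hM) (Finset.sum_nonneg fun l _ => inv_nonneg.2 (pow_nonneg hlam.le _)))
      (by positivity)
  -- each one-block piece `P_vf`
  have hpiece : ∀ v : TSite d m, ‖WL2.equiv ℂ _ W (GpOfU L m φ η U a' hpos' (PS v f)) x₀‖ ≤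
      B * Real.exp (-(κ' / 2 * tdist m (blockCoord L m x₀) v)) * F := fun v => by
    have hfv : ∀ x, blockCoord L m x ≠ v → WL2.equiv ℂ _ W (PS v f) x = 0 := fun x hx => by
      rw [hPS, if_neg hx]
    have hFv : ∀ y, ‖WL2.equiv ℂ _ W (PS v f) y‖ ≤ F := fun y => by
      rw [hPS]
      by_cases hy : blockCoord L m y = v
      · rw [if_pos hy]; exact hF y
      · rw [if_neg hy, norm_zero]; exact hF0
    exact norm_GpOfU_apply_le_decay' L m φ η U a' hpos' (c₁ := c₁) hm hR hS hPS hp₂ hCE hC₃ hM hlam hκ'.le hκ hκ₁ hP (hdec v) hW0 hx₀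
      hsup hWd hDFS (PS v f) hfv hFv (hμ v)
  -- decompose and sum
  have hsplit : GpOfU L m φ η U a' hpos' f = ∑ v, GpOfU L m φ η U a' hpos' (PS v f) := by
    rw [← map_sum, sum_block_apply hPS f]
  calc ‖WL2.equiv ℂ _ W (GpOfU L m φ η U a' hpos' f) x₀‖
      = ‖∑ v, WL2.equiv ℂ _ W (GpOfU L m φ η U a' hpos' (PS v f)) x₀‖ := by rw [hsplit, equiv_sum]
    _ ≤ ∑ v, ‖WL2.equiv ℂ _ W (GpOfU L m φ η U a' hpos' (PS v f)) x₀‖ := norm_sum_le _ _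
    _ ≤ ∑ v, B * Real.exp (-(κ' / 2 * tdist m (blockCoord L m x₀) v)) * F := Finset.sum_le_sum fun v _ => hpiece v
    _ = B * F * ∑ v, Real.exp (-(κ' / 2 * tdist m (blockCoord L m x₀) v)) := by
        rw [Finset.mul_sum]; exact Finset.sum_congr rfl fun v _ => by ring
    _ ≤ B * F * latticeConst d (κ' / 2) :=
        mul_le_mul_of_nonneg_left (torusSum_le d hm (half_pos hκ') (blockCoord L m x₀)) (mul_nonneg hB0 hF0)
    _ = B * latticeConst d (κ' / 2) * F := by ring

omit [StarModule ℂ 𝔸] in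
/-- **THE ROW SUM OF (3.42) ON THE CHAIN's CLASS, (T) INHABITED**: unitary `U`, `*`-trace, compatible fibre norm (the chain's standing letters `hU`, `hτ₂`,
`hφ`) in place of the contraction binders; letters (D-P), (D-E), (W), (D-FS), (supp) as in `norm_GpOfU_apply_le_rowSum`.
[cite: Balaban1985BackgroundPropagators, Thm 3.1 (3.42) p.397, (3.39) p.397] -/
theorem norm_GpOfU_apply_le_rowSum_unitary (hm : ∀ i, 1 ≤ m i) (τ : 𝔸 →ₗ[ℂ] ℂ) (hτ₂ : ∀ X Y : 𝔸, τ (X * Y) = τ (Y * X))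
    (hU : ∀ b, star (U b : 𝔸) = ((U b)⁻¹ : 𝔸ˣ)) (hφ : ∀ X Y : 𝔸, ⟪φ.symm X, φ.symm Y⟫_ℂ = τ (star X * Y))
    {PS : TSite d m → SiteL2K ℂ d (fineP L m) c₀ W →L[ℂ] SiteL2K ℂ d (fineP L m) c₀ W}
    (hPS : ∀ (y : TSite d m) (g : SiteL2K ℂ d (fineP L m) c₀ W) (x : TSite d (fineP L m)),
      WL2.equiv ℂ (fun _ : TSite d (fineP L m) => c₀) W (PS y g) x =
        if blockCoord L m x = y then WL2.equiv ℂ (fun _ : TSite d (fineP L m) => c₀) W g x else 0)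
    {p₂ CE C₃ M lam κ κ₁ κ' : ℝ} (hp₂ : 0 ≤ p₂) (hCE : 0 ≤ CE) (hC₃ : 0 ≤ C₃) (hM : 0 ≤ M) (hlam : 0 < lam)
    (hκ' : 0 < κ') (hκ : κ' ≤ κ) (hκ₁ : κ' < κ₁)
    (hP : ∀ (v : SiteL2K ℂ d (fineP L m) c₀ W) (x : TSite d (fineP L m)),
      ‖WL2.equiv ℂ _ W (laplacePrimeA L m φ η U a' (c₁ := c₁) v -
        covLaplaceSiteK ((η : ℂ))⁻¹ (adTransportW φ U) (adTransportW φ fun b => (U b)⁻¹) v) x‖ ≤ p₂ * ‖PS (blockCoord L m x) v‖)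
    (hdec : ∀ v y : TSite d m, ‖PS y ∘L LinearMap.toContinuousLinearMap (GpOfU L m φ η U a' hpos') ∘L PS v‖ ≤
      CE * Real.exp (-(κ * tdist m v y)))
    {x₀ : TSite d (fineP L m)} {Wt : TSite d (fineP L m) → ℝ} (hW0 : ∀ x, 0 < Wt x) (hx₀ : Wt x₀ = 1) (hsup : ∀ x, lam * Wt x ≤
      ∑ j : Fin d ⊕ Fin d, (η⁻¹) ^ 2 * (Wt x - Wt (Sum.elim (fun μ => unshift μ x) (fun μ => shift μ x) j)) + 1 * Wt x)
    (hWd : ∀ x, Real.exp (κ₁ * tdist m (blockCoord L m x₀) (blockCoord L m x)) ≤ M * Wt x) {k : ℕ}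
    (hDFS : ∀ ψ : ℕ → TSite d (fineP L m) → ℝ, (∀ j < k, ∀ x, ∑ i : Fin d ⊕ Fin d,
        (η⁻¹) ^ 2 * (ψ (j + 1) x - ψ (j + 1) (Sum.elim (fun μ => unshift μ x) (fun μ => shift μ x) i)) + 1 * ψ (j + 1) x = ψ j x) →
      ψ k x₀ ≤ C₃ * Real.sqrt (∑ y, c₀ * ψ 0 y ^ 2 / Wt y))
    (f : SiteL2K ℂ d (fineP L m) c₀ W) {F μ : ℝ} (hF : ∀ y, ‖WL2.equiv ℂ _ W f y‖ ≤ F) (hμ : ∀ v, ‖PS v f‖ ≤ Real.sqrt μ * F) :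
    ‖WL2.equiv ℂ _ W (GpOfU L m φ η U a' hpos' f) x₀‖ ≤
      ((1 + p₂ * CE * Real.sqrt μ) * M * (∑ l ∈ Finset.range k, (lam ^ (l + 1))⁻¹) +
        C₃ * Real.sqrt (M * latticeConst d (κ₁ - κ')) * CE * Real.sqrt μ) * latticeConst d (κ' / 2) * F :=
  norm_GpOfU_apply_le_rowSum L m φ η U a' hpos' hm (fun b w => (norm_adTransportW_eq φ U τ hτ₂ hU hφ b w).le)
    (fun b w => (norm_adTransportW_inv_eq φ U τ hτ₂ hU hφ b w).le) hPS hp₂ hCE hC₃ hM hlam hκ' hκ hκ₁ hP hdec hW0 hx₀ hsup hWd hDFS f hF hμ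

end Literature.MathematicalPhysics.QuantumFieldTheory.Balaban1983to89.B9Eq342GreenPrimeSupBoundDecay

end
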